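import Summits.QuantumFields.BalabanUV.T4Continuum.Support.NE7K1LinRegionLine
import Literature.MathematicalPhysics.QuantumFieldTheory.Balaban1983to89.B4Cor23Zero

/-!
# NE7K1LinRegionCor23 — row NE7 (node U5), candidate route HOM, path H1L, cell K1-lin(s): B4 COROLLARY 2.3 (2.30), FIRST PAIRING,
# FOR THE TWO-CUTOFF LINE IN THE PRINTED QUANTIFIER SHAPE — «there exist positive constants c₀, δ₀ such that for arbitrary scalar
# field configurations f, f′ defined on Ω: |⟨f, G f′⟩| ≤ c₀e^{−δ₀dist(supp f, supp f′)}‖f‖₂‖f′‖₂» with `G = (T^Ω(s))⁻¹`, ONE pair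
# `(c₀, δ₀)` in `(d, L, a±)` for EVERY mesh, EVERY `s ∈ [0,1]`, EVERY `a ∈ [a₋,a₊]`, EVERY region and EVERY `f, f′`

Lineage `b2b-balaban-t4-ne7-p2` (CRUX PROVER NE7 #2), generation 78; file 90 (display companion of 85–89, #E1 (o3-Ω)).  File 86's
`twoCutoff_inv_setDecay` is (2.30)'s first pairing for the line in SET form (explicit `S`, `T`, `ρ₀`, nonempty `T`); this file
packages it as b04's `B4Cor23Zero.cor23_main_zeroField` packages the endpoint: supports (`B4Cor23Zero.supp`), the support distance
`suppDist` (`= 0` if a support is empty — then both sides vanish anyway), counting `ℓ²` norms `l2n`, and the window's rate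
`lineRate` of file 87.

* **`cor23_line_first_pairing`** (the line `twoCutoffLine` on every union `R′` of `nL`-blocks, run-A sites `R′.image (blk L)`):
  `|⟨f, (twoCutoffLine s)⁻¹g⟩| ≤ (2L^{d+1}∕min(2,a₋))·e^{−lineRate(d,L,a₋,a₊)·dist_η(supp f, supp g)}·‖f‖₂‖g‖₂`;
* **`cor23_regionLine_first_pairing`** (the region line `T^Ω(s)` of file 87 on b04's index `↥(fineDom n Ω)`, every finite `Ω`):
  the same with `G = (regLine L hn Ω a s)⁻¹`;
* a numerical instance (`d + 1 = 4`, `L = 2`, `a₋ = a₊ = 1`: `c₀ = 32`).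

HONEST FRAMING: [folklore]; A = 0; FIRST pairing only — the three derivative pairings of (2.30) and the `δG(Ω,Ω₀)` clause are NOT typed
for the line (b04 has them for the endpoint, `B4Cor23Zero`); counting `ℓ²` norms (the paper's `η^{d+1}`-weighted norms scale both sides
alike); nothing printed asserted; no `sorry`.  Census only; NE7 NOT PRINTED ∕ NOT PROVED; spine 0∕9; FIXED FINITE T⁴, rung (B)+1; NOT
infinite volume, NOT mass gap, NOT Clay.  HONEST DEPENDENCY: continuum YM on T⁴ ⇐ BetaPertH ∧ nine spine estimates (0/9 proved); BetaPertH
⇐ (D1) ∧ (D4) ∧ CAP+tail; G-an2-4 gates asym, D1 and NE2/3/4.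
-/

noncomputable section

open Finset Matrix

namespace Summit.QuantumFields.BalabanUV.T4Continuum.NE7K1LinRegionCor23

open Literature.MathematicalPhysics.QuantumFieldTheory.Balaban1983to89
open Literature.MathematicalPhysics.QuantumFieldTheory.Balaban1983to89.B4Reflection242
open Literature.MathematicalPhysics.QuantumFieldTheory.Balaban1983to89.B4Lower18
open Literature.MathematicalPhysics.QuantumFieldTheory.Balaban1983to89.B4Cor23Zero (l2n supp suppDist suppDist_le suppDist_nonneg
  eq_zero_of_not_mem_supp abs_dot_le_of_setSq)
open NE7K1LinSchurLineU1 NE7K1LinSchurLineU1Set NE7K1LinRegionLine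

variable {d : ℕ}

/-! ### §1 From the set form to the printed form -/

section Line

variable {n L : ℕ} [NeZero L] {R' : Finset (Fin (d + 1) → ℤ)}

/-- **B4 COR. 2.3 (2.30), FIRST PAIRING, FOR THE TWO-CUTOFF LINE — PRINTED QUANTIFIER SHAPE.**  For every dimension `d + 1`, two-run
refinement `L ≥ 1` and window `0 < a₋ ≤ a₊`, the EXPLICIT `c₀ = 2L^{d+1}∕min(2,a₋)` and `δ₀ = lineRate d L a₋ a₊` serve EVERY mesh
`η = 1∕n`, EVERY `s ∈ [0,1]`, EVERY `a ∈ [a₋,a₊]`, EVERY union `R′` of `nL`-blocks and EVERY pair `f, g` on run A's sites: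
`|⟨f, (twoCutoffLine s)⁻¹g⟩| ≤ c₀·e^{−δ₀·dist_η(supp f, supp g)}·‖f‖₂‖g‖₂`. [folklore] -/
theorem cor23_line_first_pairing (hn : 1 ≤ n) (hR' : IsBlockUnion (n * L) R') {amin aplus a : ℝ} (ha : 0 < amin)
    (h1 : amin ≤ a) (h2 : a ≤ aplus) {s : ℝ} (hs0 : 0 ≤ s) (hs1 : s ≤ 1) (f g : ↥(R'.image (blk L)) → ℝ) :
    |f ⬝ᵥ (twoCutoffLine (isBlockUnion_fine hR') n a s)⁻¹.mulVec g|
      ≤ (2 / (min 2 amin / (L : ℝ) ^ (d + 1))) *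
          Real.exp (-(lineRate d L amin aplus * suppDist n (R'.image (blk L)) f g)) * l2n f * l2n g := by
  classical
  have hL : 1 ≤ L := NeZero.one_le
  have hL0 : (0 : ℝ) < L := by exact_mod_cast hL
  have ha0 : 0 < a := lt_of_lt_of_le ha h1
  set δ := lineRate d L amin aplus with hδ
  have hδ0 : 0 < δ := lineRate_pos d hL aplus ha
  have hδ1 : δ ≤ 1 := lineRate_le_one d L amin aplus
  have hsmall := lineRate_small d hL ha h1 h2
  set ρ₀ := suppDist n (R'.image (blk L)) f g with hρ₀
  set σ : ℝ := min 2 a / (L : ℝ) ^ (d + 1) with hσ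
  set σm : ℝ := min 2 amin / (L : ℝ) ^ (d + 1) with hσm
  have hσ0 : 0 < σ := div_pos (lt_min (by norm_num) ha0) (by positivity)
  have hσm0 : 0 < σm := div_pos (lt_min (by norm_num) ha) (by positivity)
  have hσle : σm ≤ σ := div_le_div_of_nonneg_right (min_le_min le_rfl h1) (by positivity)
  have hC : 2 / σ ≤ 2 / σm := div_le_div_of_nonneg_left (by norm_num) hσm0 hσle
  set X := (twoCutoffLine (isBlockUnion_fine hR') n a s)⁻¹.mulVec g with hX
  by_cases hT : (supp g).Nonempty
  · -- the set form with `S = supp f`, `T = supp g`, `ρ₀ = dist_η(supp f, supp g)`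
    have hset := (twoCutoff_inv_setDecay hn hR' ha0 hδ0.le hδ1 hsmall hs0 hs1 (supp f) (supp g) hT ρ₀
      (fun x hx t ht => suppDist_le f g hx ht) g (eq_zero_of_not_mem_supp g)).2
    have hexp : Real.exp (-(2 * (δ * ρ₀))) = Real.exp (-(δ * ρ₀)) ^ 2 := by
      rw [← Real.exp_nat_mul]; push_cast; ring_nf
    have hset' : ∑ x ∈ supp f, X x ^ 2 ≤ (2 / σ * Real.exp (-(δ * ρ₀))) ^ 2 * ∑ x, g x ^ 2 := by
      rw [mul_pow, ← hexp]
      exact hset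
    have hc : 0 ≤ 2 / σ * Real.exp (-(δ * ρ₀)) := by positivity
    have h := abs_dot_le_of_setSq f X (supp f) (eq_zero_of_not_mem_supp f) hc hset'
    have hB : Real.sqrt (∑ x, g x ^ 2) = l2n g := rfl
    rw [hB] at h
    refine h.trans ?_
    have hfg : 0 ≤ l2n f * l2n g := mul_nonneg (Real.sqrt_nonneg _) (Real.sqrt_nonneg _)
    have := mul_le_mul_of_nonneg_right (mul_le_mul_of_nonneg_right hC (Real.exp_pos (-(δ * ρ₀))).le) hfg
    linarith [this]
  · -- empty support of `g`: `g = 0`, both sides vanish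
    have hg0 : g = 0 := by
      funext x
      exact eq_zero_of_not_mem_supp g x (fun hx => hT ⟨x, hx⟩)
    have hX0 : X = 0 := by rw [hX, hg0, Matrix.mulVec_zero]
    rw [hX0, dotProduct_zero, abs_zero]
    exact mul_nonneg (mul_nonneg (mul_nonneg (div_pos two_pos hσm0).le (Real.exp_pos _).le) (Real.sqrt_nonneg _))
      (Real.sqrt_nonneg _)

end Line

/-! ### §2 The region line on b04's index -/

section Region

variable {n : ℕ} (L : ℕ) [NeZero L] {Ω : Finset (Fin (d + 1) → ℤ)}

/-- **B4 COR. 2.3 (2.30), FIRST PAIRING, FOR THE REGION LINE `T^Ω(s)` — PRINTED QUANTIFIER SHAPE**, every finite set `Ω` of unit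
labels (fine region `B^j(Ω)`), every mesh, every `s ∈ [0,1]`, every `a ∈ [a₋,a₊]`, every `f, g`:
`|⟨f, (T^Ω(s))⁻¹g⟩| ≤ (2L^{d+1}∕min(2,a₋))·e^{−lineRate·dist_η(supp f, supp g)}·‖f‖₂‖g‖₂`. [folklore] -/
theorem cor23_regionLine_first_pairing (hn : 1 ≤ n) {amin aplus a : ℝ} (ha : 0 < amin) (h1 : amin ≤ a) (h2 : a ≤ aplus)
    {s : ℝ} (hs0 : 0 ≤ s) (hs1 : s ≤ 1) (f g : ↥(fineDom n Ω) → ℝ) :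
    |f ⬝ᵥ (regLine L hn Ω a s)⁻¹.mulVec g|
      ≤ (2 / (min 2 amin / (L : ℝ) ^ (d + 1))) *
          Real.exp (-(lineRate d L amin aplus * suppDist n (fineDom n Ω) f g)) * l2n f * l2n g := by
  classical
  have hL : 1 ≤ L := NeZero.one_le
  have hL0 : (0 : ℝ) < L := by exact_mod_cast hL
  have ha0 : 0 < a := lt_of_lt_of_le ha h1
  set δ := lineRate d L amin aplus with hδ
  have hδ0 : 0 < δ := lineRate_pos d hL aplus ha
  have hδ1 : δ ≤ 1 := lineRate_le_one d L amin aplus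
  have hsmall := lineRate_small d hL ha h1 h2
  set ρ₀ := suppDist n (fineDom n Ω) f g with hρ₀
  set σ : ℝ := min 2 a / (L : ℝ) ^ (d + 1) with hσ
  set σm : ℝ := min 2 amin / (L : ℝ) ^ (d + 1) with hσm
  have hσ0 : 0 < σ := div_pos (lt_min (by norm_num) ha0) (by positivity)
  have hσm0 : 0 < σm := div_pos (lt_min (by norm_num) ha) (by positivity)
  have hσle : σm ≤ σ := div_le_div_of_nonneg_right (min_le_min le_rfl h1) (by positivity)
  have hC : 2 / σ ≤ 2 / σm := div_le_div_of_nonneg_left (by norm_num) hσm0 hσle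
  set X := (regLine L hn Ω a s)⁻¹.mulVec g with hX
  by_cases hT : (supp g).Nonempty
  · have hset := regLine_inv_setDecay L hn ha0 hδ0.le hδ1 hsmall hs0 hs1 (supp f) (supp g) hT ρ₀
      (fun x hx t ht => suppDist_le f g hx ht) g (eq_zero_of_not_mem_supp g)
    have hexp : Real.exp (-(2 * (δ * ρ₀))) = Real.exp (-(δ * ρ₀)) ^ 2 := by
      rw [← Real.exp_nat_mul]; push_cast; ring_nf
    have hset' : ∑ x ∈ supp f, X x ^ 2 ≤ (2 / σ * Real.exp (-(δ * ρ₀))) ^ 2 * ∑ x, g x ^ 2 := by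
      rw [mul_pow, ← hexp]
      exact hset
    have hc : 0 ≤ 2 / σ * Real.exp (-(δ * ρ₀)) := by positivity
    have h := abs_dot_le_of_setSq f X (supp f) (eq_zero_of_not_mem_supp f) hc hset'
    have hB : Real.sqrt (∑ x, g x ^ 2) = l2n g := rfl
    rw [hB] at h
    refine h.trans ?_
    have hfg : 0 ≤ l2n f * l2n g := mul_nonneg (Real.sqrt_nonneg _) (Real.sqrt_nonneg _)
    have := mul_le_mul_of_nonneg_right (mul_le_mul_of_nonneg_right hC (Real.exp_pos (-(δ * ρ₀))).le) hfg
    linarith [this]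
  · have hg0 : g = 0 := by
      funext x
      exact eq_zero_of_not_mem_supp g x (fun hx => hT ⟨x, hx⟩)
    have hX0 : X = 0 := by rw [hX, hg0, Matrix.mulVec_zero]
    rw [hX0, dotProduct_zero, abs_zero]
    exact mul_nonneg (mul_nonneg (mul_nonneg (div_pos two_pos hσm0).le (Real.exp_pos _).le) (Real.sqrt_nonneg _))
      (Real.sqrt_nonneg _)

/-- Sanity instance (non-vacuity, explicit numbers): `d + 1 = 4`, refinement `L = 2`, `a₋ = a₊ = a = 1` (`min(2,1) = 1`,
`c₀ = 2·2⁴ = 32`), mesh `η = 1∕5`, `s = 1∕2`: for EVERY finite `Ω ⊂ ℤ⁴` and every `f, g` on the fine region,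
`|⟨f, (T^Ω(½))⁻¹g⟩| ≤ 32·e^{−lineRate(3,2,1,1)·dist_η(supp f, supp g)}‖f‖₂‖g‖₂`. -/
example (Ω : Finset (Fin (3 + 1) → ℤ)) (f g : ↥(fineDom 5 Ω) → ℝ) :
    |f ⬝ᵥ (regLine 2 (by norm_num : 1 ≤ 5) Ω 1 (1 / 2))⁻¹.mulVec g|
      ≤ 32 * Real.exp (-(lineRate 3 2 1 1 * suppDist 5 (fineDom 5 Ω) f g)) * l2n f * l2n g := by
  have h := cor23_regionLine_first_pairing (d := 3) 2 (by norm_num : 1 ≤ 5) (Ω := Ω) one_pos le_rfl le_rfl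
    (by norm_num : (0 : ℝ) ≤ 1 / 2) (by norm_num : (1 : ℝ) / 2 ≤ 1) f g
  have hc : (2 : ℝ) / (min 2 (1 : ℝ) / ((2 : ℕ) : ℝ) ^ (3 + 1)) = 32 := by
    rw [min_eq_right (by norm_num : (1 : ℝ) ≤ 2)]; norm_num
  rwa [hc] at h

end Region

end Summit.QuantumFields.BalabanUV.T4Continuum.NE7K1LinRegionCor23
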